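import Summits.QuantumFields.YangMills.Theorems.BalabanUVNodesN16Thm4ZdPrintReadouts
import Summits.QuantumFields.YangMills.Theorems.BalabanUVNodesN16TorusShift
import HarnessLib

/-!
# Route «BalabanUVNodes», cluster K4 «SpineRates» — node N16 = NE3: THE MULTI-SCALE READ-OUTS of print's (1.36)₃ ∕ [B9] (3.40) Hölder supremum at the
# ALL-TORUS member (repair R-β″, PRODUCER HALF, brick 2): the quotient bound at EVERY admissible pair, its size along a lattice line in the word-holonomy
# letter `conjR (hol U₀ y (seg μ j))`, and the translation covariance of print's transport ∕ quotient (for the periodicity principle)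

Cell `pub-ymgap`, seat `pub-ymgap-dag-n16-c` (R134 fan-out seat, strategy s1; HUMAN RULING D-0062; chair R424 venue), generation 4, file 24.
`--supports stmt-QuantumFields-19912 --as helper` (K3‴ `SpineGivenEndpointR13`, route rev 16; lineage K3′ 19908).  `bears_on: R4∕N16 · edge N05 → N16`.
Located item: `HOME/pub-ymgap-dag-n16-c/LOCATED-N16-HOLDER-PIN.md`, census row R-β″ (ADDENDUM 5); brick 1 = file 23 `BalabanUVNodesN16HolderMSDictionary`.

WHY.  Generation 0's `Thm4ZdPrintReadouts.holder_pointwise_of_msup` reads node N05's weighted Hölder supremum (`zdGF3`'s Proposition-3 body: `msup` of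
`B9Eq340HolderZd.hquot` over ALL of `AdmPair η len`) only at the nearest-neighbour pairs `(y, y + e_μ)` — whence the chain of record's (Lip₂′ᶜ) and the window
β > 2∕3.  The multi-scale road R-β″ reads it at every admissible pair (§1), in particular at the line pairs `(y, y + j•e_μ)`, `1 ≤ j ≤ L^k`, where print's transport
«R(U₀(Γ_{y,y′}))» is conjugation by the word holonomy along the straight segment (§2) — the letter of brick 1's `norm_holderDiffMS_AdInv_le` ∕
`lipMS_AdInv_of_printLetters`.  §3 records that print's transport and quotient are translation covariant (`B12Ineq417Flat.hol_shiftCfg`), the input the MS twin of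
generation 0's periodicity principle (`Thm4TorusOfZd.conclZd_shiftCfg`) needs for the multi-scale line of the print list.

WHAT THIS FILE PROVES (kernel, theorems only, 0 `def`, 0 sorry):
§1 `hquot_le_of_msup_univ` (at `Ω_j = ℤᵈ`: the weighted supremum bound `≤ c` gives `hquot ≤ c·(Lᵏη)^{−(2+β)}` at EVERY admissible pair),
   `norm_trans_sub_le_of_msup_univ` (its size: `‖R(U₀(Γ_{y,y′}))(D^η_{U₀,μ}A_κ)(y′) − (D^η_{U₀,μ}A_κ)(y)‖ ≤ c·(Lᵏη)^{−(2+β)}·(η·len(y′ − y))^β`).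
§2 `trans_line_eq_conjR_hol_seg` (`R(U₀(Γ_{y,y+j•e_μ})) = conjR (hol U₀ y (seg μ j))`, any normed ring), `norm_conjR_hol_seg_sub_le_of_msup_univ` (the line
   read-out: `≤ c·(Lᵏη)^{−(2+β)}·(η·j)^β` when `len (j•e_μ) ≤ j`).
§3 `trans_shiftCfg`, `hquot_shiftCfg_shiftCfg` (translation covariance of (3.40)'s transport and quotient).
HONEST FRAMING: bookkeeping over landed modules; the supremum bound is a HYPOTHESIS (node N05's [B8] Prop 3 at the member, NOT proved); N16 ∕ NE3 NOT discharged;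
count-neutral; one finite four-torus at fixed ε — NOT ℝ⁴, NOT infinite volume, NOT OS, NOT a mass gap, NOT Clay.
-/

set_option autoImplicit false

open scoped BigOperators
open NormedSpace

namespace Summit.QuantumFields.YangMills.BalabanUVNodes.N16HolderMSReadouts

open Literature.MathematicalPhysics.QuantumFieldTheory.Balaban1983to89
open B7Prop1Explicit B7Prop2Explicit
open B7Eq78Linearization (conjR)
open B8Ineq132 (covDerivFwd)
open B8Eq155JBound (gradNorm2 gradNorm2_nonneg)
open B8Lemma1NonAbelian (treeWord_zsmul_e)
open B8ScaledSupNorm (msup weight Bdd bdd_of_forall norm_le_of_msup_le scale_pos)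
open B9Eq340HolderZd (hquot hquot_def AdmPair mem_admPair trans trans_def hquot_le_of_141)
open B12Ineq417Flat (shiftCfg shiftCfg_apply hol_shiftCfg)

noncomputable section

variable {d : ℕ}

section Readouts

variable {𝔸 : Type} [CStarAlgebra 𝔸] [Nontrivial 𝔸]

/-! ## §1 The (3.40) quotient bound at EVERY admissible pair of the all-torus member -/

/-- **(1.36)₃ AT EVERY ADMISSIBLE PAIR FROM ITS WEIGHTED SUPREMUM ON THE ALL-TORUS MEMBER**: `‖∇^η_{U₀}A‖_{β}-sup ≤ c` (the [4] (3.40) quotients over the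
admissible pairs starting in `Ω_j = ℤᵈ`, weight `(Lʲη)^{2+β}`), `β ≥ 0`, `len ≥ 1` on its support, `‖A‖ ≤ a(Lᵏη)⁻¹`, `U₀` unitary-valued ⟹ at every admissible pair
`p`: `hquot η β len U₀ (D^η_{U₀,μ}A_κ) p ≤ c·(Lᵏη)^{−(2+β)}` (generation 0's `holder_pointwise_of_msup` before its nearest-neighbour specialisation).
[cite: Balaban1985RegularSpaces, (1.36) p.82; Balaban1985BackgroundPropagators, (3.40) p.397] -/
theorem hquot_le_of_msup_univ {L k : ℕ} (hL : 1 ≤ L) {η β : ℝ} (hη : 0 < η) (hβ : 0 ≤ β) {len : Site d → ℝ}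
    (hlen : ∀ v : Site d, 0 < len v → 1 ≤ len v) {Ω : ℕ → Set (Site d)} (hΩ : ∀ j, Ω j = Set.univ)
    {U₀ : Site d → Fin d → 𝔸ˣ} (hU₀ : ∀ y κ, U₀ y κ ∈ unitaryUnits 𝔸) {A : Site d → Fin d → 𝔸} {a : ℝ}
    (hA : ∀ y κ, ‖A y κ‖ ≤ a * ((L : ℝ) ^ k * η)⁻¹) {c : ℝ}
    (hm : msup L k η (-(2 + β)) (fun j (q : Fin d × Fin d × (Site d × Site d)) => q.2.2 ∈ AdmPair η len ∧ q.2.2.1 ∈ Ω j)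
      (fun q => hquot η β len U₀ (covDerivFwd η U₀ q.1 (fun z => A z q.2.1)) q.2.2) ≤ c)
    (μ κ : Fin d) {p : Site d × Site d} (hp : p ∈ AdmPair η len) :
    hquot η β len U₀ (covDerivFwd η U₀ μ (fun z => A z κ)) p ≤ c * ((L : ℝ) ^ k * η) ^ (-(2 + β)) := by
  have h1 : ∀ y κ, U₀ y κ ∈ U1 𝔸 := fun y κ => unitaryUnits_le_U1 (hU₀ y κ)
  have hLpos : 0 < L := hL
  have hB : Bdd L k η (-(2 + β)) (fun j (q : Fin d × Fin d × (Site d × Site d)) => q.2.2 ∈ AdmPair η len ∧ q.2.2.1 ∈ Ω j)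
      (fun q => hquot η β len U₀ (covDerivFwd η U₀ q.1 (fun z => A z q.2.1)) q.2.2) := by
    refine bdd_of_forall (c := ((L : ℝ) ^ k * η) ^ (-(-(2 + β))) *
      (2 * ((((L : ℝ) ^ k * η)⁻¹) ^ 2 * gradNorm2 η L k U₀ A) * (η ^ β)⁻¹)) fun j hj q hq => ?_
    have hLr : (1 : ℝ) ≤ L := by exact_mod_cast hL
    have hw : weight L η (-(2 + β)) j ≤ ((L : ℝ) ^ k * η) ^ (-(-(2 + β))) := by
      unfold weight
      exact Real.rpow_le_rpow (scale_pos hL hη j).le (mul_le_mul_of_nonneg_right (pow_le_pow_right₀ hLr hj) hη.le) (by linarith)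
    have hq0 : 0 ≤ hquot η β len U₀ (covDerivFwd η U₀ q.1 (fun z => A z q.2.1)) q.2.2 :=
      B9Eq340HolderZd.hquot_nonneg hη.le β U₀ _ hq.1
    rw [Real.norm_of_nonneg hq0]
    exact mul_le_mul hw (hquot_le_of_141 hη hβ hlen hLpos k h1 hA q.1 q.2.1 hq.1) hq0
      (Real.rpow_nonneg (scale_pos hL hη k).le _)
  have hmem : p ∈ AdmPair η len ∧ p.1 ∈ Ω k := ⟨hp, by rw [hΩ k]; exact Set.mem_univ _⟩
  have h := norm_le_of_msup_le hL hη hB hm (j := k) le_rfl (i := (μ, κ, p)) hmem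
  have hq0 : 0 ≤ hquot η β len U₀ (covDerivFwd η U₀ μ (fun z => A z κ)) p := B9Eq340HolderZd.hquot_nonneg hη.le β U₀ _ hp
  rwa [Real.norm_of_nonneg hq0] at h

/-- **… ITS SIZE**: at every admissible pair `(y, y′)`, `‖R(U₀(Γ_{y,y′}))(D^η_{U₀,μ}A_κ)(y′) − (D^η_{U₀,μ}A_κ)(y)‖ ≤ c·(Lᵏη)^{−(2+β)}·(η·len(y′ − y))^β`.
[cite: Balaban1985RegularSpaces, (1.36) p.82; Balaban1985BackgroundPropagators, (3.40) p.397] -/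
theorem norm_trans_sub_le_of_msup_univ {L k : ℕ} (hL : 1 ≤ L) {η β : ℝ} (hη : 0 < η) (hβ : 0 ≤ β) {len : Site d → ℝ}
    (hlen : ∀ v : Site d, 0 < len v → 1 ≤ len v) {Ω : ℕ → Set (Site d)} (hΩ : ∀ j, Ω j = Set.univ)
    {U₀ : Site d → Fin d → 𝔸ˣ} (hU₀ : ∀ y κ, U₀ y κ ∈ unitaryUnits 𝔸) {A : Site d → Fin d → 𝔸} {a : ℝ}
    (hA : ∀ y κ, ‖A y κ‖ ≤ a * ((L : ℝ) ^ k * η)⁻¹) {c : ℝ}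
    (hm : msup L k η (-(2 + β)) (fun j (q : Fin d × Fin d × (Site d × Site d)) => q.2.2 ∈ AdmPair η len ∧ q.2.2.1 ∈ Ω j)
      (fun q => hquot η β len U₀ (covDerivFwd η U₀ q.1 (fun z => A z q.2.1)) q.2.2) ≤ c)
    (μ κ : Fin d) {y y' : Site d} (hp : (y, y') ∈ AdmPair η len) :
    ‖trans U₀ y y' (covDerivFwd η U₀ μ (fun z => A z κ) y') - covDerivFwd η U₀ μ (fun z => A z κ) y‖
      ≤ c * ((L : ℝ) ^ k * η) ^ (-(2 + β)) * (η * len (y' - y)) ^ β := by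
  have h := hquot_le_of_msup_univ hL hη hβ hlen hΩ hU₀ hA hm μ κ hp
  have hden : 0 < (η * len (y' - y)) ^ β := Real.rpow_pos_of_pos (mul_pos hη (mem_admPair.mp hp).1) β
  rw [hquot_def, div_le_iff₀ hden] at h
  exact h

/-! ## §2 Along a lattice line: the word-holonomy letter -/

omit [Nontrivial 𝔸] in
/-- **PRINT's (3.40) TRANSPORT ALONG A LATTICE LINE** (any normed ring): `R(U₀(Γ_{y, y+j•e_μ}))X = conjR (hol U₀ y (seg μ j)) X` — the staircase contour to
`y + j•e_μ` is the straight segment (`B8Lemma1NonAbelian.treeWord_zsmul_e`). [cite: Balaban1985BackgroundPropagators, (3.40) p.397] -/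
theorem trans_line_eq_conjR_hol_seg (U₀ : Site d → Fin d → 𝔸ˣ) (y : Site d) (μ : Fin d) (j : ℕ) (X : 𝔸) :
    trans U₀ y (y + j • e μ) X = conjR (hol U₀ y (seg μ (j : ℤ))) X := by
  rw [trans_def, add_sub_cancel_left, ← natCast_zsmul, treeWord_zsmul_e]

/-- **THE LINE READ-OUT**: at the all-torus member, for an admissible line pair `(y, y + j•e_μ)` with `len (j•e_μ) ≤ j`:
`‖conjR (hol U₀ y (seg μ j)) (D^η_{U₀,μ}A_κ)(y + j•e_μ) − (D^η_{U₀,μ}A_κ)(y)‖ ≤ c·(Lᵏη)^{−(2+β)}·(η·j)^β` (`c ≥ 0`) — the hypothesis of brick 1's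
`N16HolderMSDictionary.norm_holderDiffMS_AdInv_le` main term, at `B = c·(Lᵏη)^{−(2+β)}`.
[cite: Balaban1985RegularSpaces, (1.36) p.82; Balaban1985BackgroundPropagators, (3.40) p.397] -/
theorem norm_conjR_hol_seg_sub_le_of_msup_univ {L k : ℕ} (hL : 1 ≤ L) {η β : ℝ} (hη : 0 < η) (hβ : 0 ≤ β) {len : Site d → ℝ}
    (hlen : ∀ v : Site d, 0 < len v → 1 ≤ len v) {Ω : ℕ → Set (Site d)} (hΩ : ∀ j, Ω j = Set.univ)
    {U₀ : Site d → Fin d → 𝔸ˣ} (hU₀ : ∀ y κ, U₀ y κ ∈ unitaryUnits 𝔸) {A : Site d → Fin d → 𝔸} {a : ℝ}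
    (hA : ∀ y κ, ‖A y κ‖ ≤ a * ((L : ℝ) ^ k * η)⁻¹) {c : ℝ} (hc : 0 ≤ c)
    (hm : msup L k η (-(2 + β)) (fun j (q : Fin d × Fin d × (Site d × Site d)) => q.2.2 ∈ AdmPair η len ∧ q.2.2.1 ∈ Ω j)
      (fun q => hquot η β len U₀ (covDerivFwd η U₀ q.1 (fun z => A z q.2.1)) q.2.2) ≤ c)
    (μ κ : Fin d) {y : Site d} {j : ℕ} (hp : (y, y + j • e μ) ∈ AdmPair η len) (hlenj : len (j • e μ) ≤ j) :
    ‖conjR (hol U₀ y (seg μ (j : ℤ))) (covDerivFwd η U₀ μ (fun z => A z κ) (y + j • e μ)) - covDerivFwd η U₀ μ (fun z => A z κ) y‖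
      ≤ c * ((L : ℝ) ^ k * η) ^ (-(2 + β)) * (η * j) ^ β := by
  have h := norm_trans_sub_le_of_msup_univ hL hη hβ hlen hΩ hU₀ hA hm μ κ hp
  rw [trans_line_eq_conjR_hol_seg, add_sub_cancel_left] at h
  have hl0 : 0 < len (j • e μ) := by simpa using (mem_admPair.mp hp).1
  refine h.trans (mul_le_mul_of_nonneg_left ?_ (mul_nonneg hc (Real.rpow_nonneg (scale_pos hL hη k).le _)))
  exact Real.rpow_le_rpow (mul_nonneg hη.le hl0.le) (mul_le_mul_of_nonneg_left hlenj hη.le) hβ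

end Readouts

/-! ## §3 Translation covariance of print's transport and quotient (for the periodicity principle) -/

section Shift

variable {𝔸 : Type*} [NormedRing 𝔸] [NormOneClass 𝔸] [NormedAlgebra ℂ 𝔸] [CompleteSpace 𝔸]

omit [NormOneClass 𝔸] [NormedAlgebra ℂ 𝔸] [CompleteSpace 𝔸] in
/-- **(3.40)'s transport is translation covariant**: `R((t_vU₀)(Γ_{x,x′}))X = R(U₀(Γ_{x+v,x′+v}))X` (`B12Ineq417Flat.hol_shiftCfg`). [folklore] -/
theorem trans_shiftCfg (U₀ : Site d → Fin d → 𝔸ˣ) (v x x' : Site d) (X : 𝔸) :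
    trans (shiftCfg v U₀) x x' X = trans U₀ (x + v) (x' + v) X := by
  rw [trans_def, trans_def, hol_shiftCfg, add_sub_add_right_eq_sub]

omit [NormOneClass 𝔸] [NormedAlgebra ℂ 𝔸] [CompleteSpace 𝔸] in
/-- **(3.40)'s quotient is translation covariant**: the quotient of the translated field `t_vF` against the translated background `t_vU₀` at the pair
`(x, x′)` is the quotient of `F` against `U₀` at `(x + v, x′ + v)`. [cite: Balaban1985BackgroundPropagators, (3.40) p.397] [folklore] -/
theorem hquot_shiftCfg_shiftCfg (η β : ℝ) (len : Site d → ℝ) (U₀ : Site d → Fin d → 𝔸ˣ) (F : Site d → 𝔸) (v : Site d) (p : Site d × Site d) :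
    hquot η β len (shiftCfg v U₀) (shiftCfg v F) p = hquot η β len U₀ F (p.1 + v, p.2 + v) := by
  rw [hquot_def, hquot_def, trans_shiftCfg, shiftCfg_apply, shiftCfg_apply, add_sub_add_right_eq_sub]

omit [NormOneClass 𝔸] [NormedAlgebra ℂ 𝔸] [CompleteSpace 𝔸] in
/-- A pair is admissible iff its translate is (admissibility reads only the displacement). [cite: Balaban1985BackgroundPropagators, (3.40) p.397] [folklore] -/
theorem mem_admPair_shift_iff (η : ℝ) (len : Site d → ℝ) (v : Site d) (p : Site d × Site d) :
    (p.1 + v, p.2 + v) ∈ AdmPair η len ↔ p ∈ AdmPair η len := by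
  rw [mem_admPair, mem_admPair, add_sub_add_right_eq_sub]

omit [NormOneClass 𝔸] [CompleteSpace 𝔸] in
/-- **THE (1.36)₃ QUOTIENT OF THE TRANSLATED FIELD `t_v(D^η_{U₀}A)`** against the `v`-periodic background: for `v`-periodic `U₀`
(`shiftCfg v U₀ = U₀`), `hquot … U₀ (D^η_{U₀,μ}(t_vA)_κ) p = hquot … U₀ (D^η_{U₀,μ}A_κ) (p + v)` — the multi-scale line of the print list is translation
covariant exactly like its nearest-neighbour companion (generation 1's `covDerivFwd_shiftCfg`). [folklore] -/
theorem hquot_covDerivFwd_shiftCfg_of_periodic (η β : ℝ) (len : Site d → ℝ) {U₀ : Site d → Fin d → 𝔸ˣ} {v : Site d}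
    (hU₀ : shiftCfg v U₀ = U₀) (μ κ : Fin d) (A : Site d → Fin d → 𝔸) (p : Site d × Site d) :
    hquot η β len U₀ (covDerivFwd η U₀ μ (fun z => shiftCfg v A z κ)) p
      = hquot η β len U₀ (covDerivFwd η U₀ μ (fun z => A z κ)) (p.1 + v, p.2 + v) := by
  have hF : covDerivFwd η U₀ μ (fun z => shiftCfg v A z κ) = shiftCfg v (covDerivFwd η U₀ μ (fun z => A z κ)) := by
    funext x
    have h := N16.TorusShift.covDerivFwd_shiftCfg η U₀ μ (fun z => A z κ) v x
    rw [hU₀] at h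
    rw [shiftCfg_apply, ← h]
    rfl
  calc hquot η β len U₀ (covDerivFwd η U₀ μ (fun z => shiftCfg v A z κ)) p
      = hquot η β len (shiftCfg v U₀) (shiftCfg v (covDerivFwd η U₀ μ (fun z => A z κ))) p := by rw [hU₀, hF]
    _ = hquot η β len U₀ (covDerivFwd η U₀ μ (fun z => A z κ)) (p.1 + v, p.2 + v) := hquot_shiftCfg_shiftCfg η β len U₀ _ v p

end Shift

end

end Summit.QuantumFields.YangMills.BalabanUVNodes.N16HolderMSReadouts
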